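import Mathlib.CategoryTheory.SingleObj
import Literature.AlgebraicGeometry.Frobenioids.FSMFFNaturalEndomorphisms
import HarnessLib

/-!
# Frobenioids I, §0: central elements of a monoid whose one-object category is of FSMFF-type

S. Mochizuki, *The geometry of Frobenioids I: the general theory*, Kyushu J. Math. **62** (2008), §0
"Categories", kurims pp. 14–18 (FSM-morphisms, totally epimorphic categories, categories of FSMFF-type) and
Remark 3.1.3, kurims p. 58: the one-object category of the multiplicative monoid `ℕ_{≥1}` is not of FSMFF-type
[cite: MochizukiFrdI2008, Rem. 3.1.3 p.58].

PROOF-ONLY companion (abc-iut cell, seat abc-iut-f-135 gen 3) of `FSMFFNaturalEndomorphisms.lean` (in a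
totally epimorphic category of FSMFF-type every natural endomorphism of the identity functor is invertible):
the ONE-OBJECT reading.  A central element `m` of a monoid `M` is a natural endomorphism of `𝟭 (SingleObj M)`
(naturality = centrality), so if `SingleObj M` is totally epimorphic and of FSMFF-type then `m` is a unit —
the general form of the pattern of Remark 3.1.3 (tree: `not_isOfFSMFFType_singleObj_pnat`,
`isOfFSMFFType_singleObj_iff_forall_isUnit` for commutative left-cancellative `M`); here `M` is arbitrary and
only CENTRAL elements are constrained.  Cell use (bookkeeping): a one-object base category `D = SingleObj M` of
a tempered Frobenioid meeting [EtTh] Def. 3.6 (ii) / Cor. 3.8 (`Cor38Hyp.fsmff`) has NO central non-invertible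
base endomorphism; non-central non-invertible ones (e.g. the dilations of `ℤ ⋊ ℕ_{≥1}`) are not excluded.
No definition is introduced; nothing here bears on [IUTchIII] Cor. 3.12; typed ≠ proved.
-/

namespace Literature.AlgebraicGeometry.Frobenioids

open CategoryTheory

universe u

/-- In `SingleObj M`, an arrow that is an isomorphism is a unit of `M`. [folklore] -/
private theorem SingleObj.isUnit_of_isIso' {M : Type u} [Monoid M] {x y : SingleObj M} (f : x ⟶ y)
    [IsIso f] : IsUnit (show M from f) := by
  refine ⟨⟨f, inv f, ?_, ?_⟩, rfl⟩
  · have h := IsIso.inv_hom_id f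
    rwa [SingleObj.comp_as_mul, SingleObj.id_as_one] at h
  · have h := IsIso.hom_inv_id f
    rwa [SingleObj.comp_as_mul, SingleObj.id_as_one] at h

/-- **For a monoid `M` whose one-object category `SingleObj M` is totally epimorphic and of FSMFF-type, every
central element of `M` is a unit**: a central `m` is a natural endomorphism of `𝟭 (SingleObj M)`, whose
components are invertible (`IsOfFSMFFType.isIso_app_natTrans_id_of_isTotallyEpimorphic`, [FrdI] §0 pp. 15,
18).  General form of the pattern of Remark 3.1.3 (`M = ℕ_{≥1}`: every element central, only `1` a unit).
[cite: MochizukiFrdI2008, Rem. 3.1.3 p.58] -/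
theorem isUnit_of_mem_center_of_isOfFSMFFType_singleObj {M : Type u} [Monoid M]
    (hC : IsOfFSMFFType (SingleObj M)) (hE : IsTotallyEpimorphic (SingleObj M)) {m : M}
    (hm : m ∈ Submonoid.center M) : IsUnit m := by
  -- the central element `m` as an endomorphism of `𝟭 (SingleObj M)` (naturality = centrality)
  let c : 𝟭 (SingleObj M) ⟶ 𝟭 (SingleObj M) :=
    { app := fun _ => m
      naturality := fun _ _ f => by
        simp only [Functor.id_obj, Functor.id_map, SingleObj.comp_as_mul]
        exact (Submonoid.mem_center_iff.mp hm f).symm }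
  haveI := hC.isIso_app_natTrans_id_of_isTotallyEpimorphic hE c (SingleObj.star M)
  exact SingleObj.isUnit_of_isIso' (c.app (SingleObj.star M))

/-- For a monoid `M` with `SingleObj M` totally epimorphic and of FSMFF-type, the centre of `M` is contained
in its submonoid of units. [cite: MochizukiFrdI2008, Rem. 3.1.3 p.58] -/
theorem center_le_isUnitSubmonoid_of_isOfFSMFFType_singleObj {M : Type u} [Monoid M]
    (hC : IsOfFSMFFType (SingleObj M)) (hE : IsTotallyEpimorphic (SingleObj M)) :
    Submonoid.center M ≤ IsUnit.submonoid M :=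
  fun _ hm => isUnit_of_mem_center_of_isOfFSMFFType_singleObj hC hE hm

/-- Consequently a monoid with a central NON-unit has a one-object category that is not simultaneously
totally epimorphic and of FSMFF-type (any commutative monoid that is not a group, e.g. `ℕ_{≥1}`: Remark
3.1.3). [cite: MochizukiFrdI2008, Rem. 3.1.3 p.58] -/
theorem not_isOfFSMFFType_and_isTotallyEpimorphic_singleObj_of_mem_center {M : Type u} [Monoid M]
    {m : M} (hm : m ∈ Submonoid.center M) (hu : ¬ IsUnit m) :
    ¬ (IsOfFSMFFType (SingleObj M) ∧ IsTotallyEpimorphic (SingleObj M)) :=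
  fun h => hu (isUnit_of_mem_center_of_isOfFSMFFType_singleObj h.1 h.2 hm)

/-- In particular, for a COMMUTATIVE monoid `M` whose one-object category is totally epimorphic and of
FSMFF-type, every element is a unit (`M` is a group) — Remark 3.1.3's pattern without the left-cancellation
hypothesis of the tree's `isOfFSMFFType_singleObj_iff_forall_isUnit`, at the price of total epimorphicity.
[cite: MochizukiFrdI2008, Rem. 3.1.3 p.58] -/
theorem isUnit_of_isOfFSMFFType_singleObj_comm {M : Type u} [CommMonoid M]
    (hC : IsOfFSMFFType (SingleObj M)) (hE : IsTotallyEpimorphic (SingleObj M)) (m : M) : IsUnit m :=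
  isUnit_of_mem_center_of_isOfFSMFFType_singleObj hC hE
    (Submonoid.mem_center_iff.mpr fun g => mul_comm g m)

end Literature.AlgebraicGeometry.Frobenioids

-- tree-health (abc-iut-w6-d081 g5, 2026-08-26T18:36Z): comment-only re-land of a STRANDED ACCEPT (accepted 16:16–16:20Z; serial farm import probe at 18:2xZ answers rc 75 «remote:stale:unbuilt», ≥ 120 min; dag tick #10 DIRECTOR FIELDS «accepted-without-olean > 60 min»);
-- declarations byte-identical to the accepted version; purpose = trigger the rebuild (rule of record: a re-land outside a reload window is served in 10–27 min). No content change.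
-- tree-health (abc-iut-w6-d081 g5, 2026-08-26T19:49Z): SECOND comment-only re-land — the first re-land (18:37–18:55Z) was itself not built after 60 min while 1,064 of 1,069 files committed 18:34–18:59Z hub-wide were (the 5 exceptions all in Literature/AnabelianGeometry + Literature/AlgebraicGeometry/Frobenioids); declarations byte-identical.
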